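import Summits.Ventures.PercRepro.Lemma6

/-!
# PercRepro — relabelling invariance of `Φ⁺`, and the dossier chain with one named gap (typer-2, gen 3)

The oriented, first-mark statements `Lemma6GenSure` / `Concavity5bSure` speak about the mark `a`
and the endpoint `u = G.fst g`; the choose-the-edge induction needs concavity along an edge with
ANY of the four marks sure-connected to EITHER endpoint.  Two invariances close the gap:

* `law4_comp_swap`, `phiPlus_swap01/02/03` — the law of the marked partition permutes its rows under
  a transposition of the marks, and `Φ⁺` is invariant (it is `S₄`-symmetric);
* `law4_flipEdge`, `phiPlus_flipEdge` — neither sees the orientation of an edge;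
* **`Concavity5Sure_of_Lemma6GenSure_5bSure`** (with `TypeIdentity`) and
  **`C011_of_Lemma6GenSure_5bSure`** : `TypeIdentity → Lemma6GenSure → Concavity5bSure → C011`
  — the whole chain of `LEAD-C011-concavity.md` §8–§10.4 in the kernel, `TypeIdentity` being its
  single named gap.
-/

namespace PercRepro

open Finset

/-- Two labellings with the same equality pattern have the same kernel. -/
theorem Setoid.ker_eq_of_iff {f g : Fin 4 → ℕ} (h : ∀ i j, f i = f j ↔ g i = g j) :
    Setoid.ker f = Setoid.ker g := by
  ext i j
  simp only [Setoid.ker_def]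
  exact h i j

namespace MultiGraph

variable {V E : Type*} (G : MultiGraph V E) [Fintype E] [DecidableEq E]

omit [Fintype E] [DecidableEq E] in
/-- Reindexing the marks by a permutation reindexes the labels of a partition event. -/
theorem partitionEvent_comp_equiv {k : ℕ} (m : Fin k → V) (τ : Equiv.Perm (Fin k))
    (r : Fin k → ℕ) : G.partitionEvent (m ∘ τ) r = G.partitionEvent m (r ∘ τ.symm) := by
  ext ω
  simp only [partitionEvent, Set.mem_setOf_eq, Function.comp]
  constructor
  · intro h i j
    have := h (τ.symm i) (τ.symm j)
    simpa using this
  · intro h i j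
    have := h (τ i) (τ j)
    simpa using this

omit [Fintype E] [DecidableEq E] in
/-- A partition event depends only on the kernel of its labels. -/
theorem partitionEvent_congr_ker (m : Fin 4 → V) {r r' : Fin 4 → ℕ}
    (h : Setoid.ker r = Setoid.ker r') : G.partitionEvent m r = G.partitionEvent m r' := by
  rw [G.partitionEvent_eq_partitionSetoidEvent m r, G.partitionEvent_eq_partitionSetoidEvent m r',
    h]

/-- The row permutation induced on `rgs4` by exchanging the marks `0` and `1`. -/
def rowSwap01 : Fin 15 → Fin 15 := ![0, 1, 2, 3, 4, 9, 8, 10, 6, 5, 7, 12, 11, 13, 14]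

/-- The row permutation induced on `rgs4` by exchanging the marks `0` and `2`. -/
def rowSwap02 : Fin 15 → Fin 15 := ![0, 1, 9, 8, 10, 5, 6, 7, 3, 2, 4, 13, 12, 11, 14]

/-- The row permutation induced on `rgs4` by exchanging the marks `0` and `3`. -/
def rowSwap03 : Fin 15 → Fin 15 := ![0, 9, 2, 6, 12, 5, 3, 13, 8, 1, 10, 11, 4, 7, 14]

/-- The kernel check for `rowSwap01`. -/
theorem rgs4_swap01 : ∀ s : Fin 15, ∀ i j : Fin 4,
    (rgs4 s ∘ (Equiv.swap (0 : Fin 4) 1)) i = (rgs4 s ∘ (Equiv.swap (0 : Fin 4) 1)) j ↔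
      rgs4 (rowSwap01 s) i = rgs4 (rowSwap01 s) j := by decide

/-- The kernel check for `rowSwap02`. -/
theorem rgs4_swap02 : ∀ s : Fin 15, ∀ i j : Fin 4,
    (rgs4 s ∘ (Equiv.swap (0 : Fin 4) 2)) i = (rgs4 s ∘ (Equiv.swap (0 : Fin 4) 2)) j ↔
      rgs4 (rowSwap02 s) i = rgs4 (rowSwap02 s) j := by decide

/-- The kernel check for `rowSwap03`. -/
theorem rgs4_swap03 : ∀ s : Fin 15, ∀ i j : Fin 4,
    (rgs4 s ∘ (Equiv.swap (0 : Fin 4) 3)) i = (rgs4 s ∘ (Equiv.swap (0 : Fin 4) 3)) j ↔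
      rgs4 (rowSwap03 s) i = rgs4 (rowSwap03 s) j := by decide

/-- The law after exchanging the marks `a, b`. -/
theorem law4_swap01 (p : E → ℝ) (a b c d : V) (s : Fin 15) :
    G.law4 p b a c d s = G.law4 p a b c d (rowSwap01 s) := by
  have hm : (![b, a, c, d] : Fin 4 → V) = ![a, b, c, d] ∘ (Equiv.swap (0 : Fin 4) 1) := by
    funext i; fin_cases i <;> rfl
  simp only [law4]
  rw [hm, G.partitionEvent_comp_equiv, Equiv.symm_swap,
    G.partitionEvent_congr_ker _ (Setoid.ker_eq_of_iff (rgs4_swap01 s))]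

/-- The law after exchanging the marks `a, c`. -/
theorem law4_swap02 (p : E → ℝ) (a b c d : V) (s : Fin 15) :
    G.law4 p c b a d s = G.law4 p a b c d (rowSwap02 s) := by
  have hm : (![c, b, a, d] : Fin 4 → V) = ![a, b, c, d] ∘ (Equiv.swap (0 : Fin 4) 2) := by
    funext i; fin_cases i <;> rfl
  simp only [law4]
  rw [hm, G.partitionEvent_comp_equiv, Equiv.symm_swap,
    G.partitionEvent_congr_ker _ (Setoid.ker_eq_of_iff (rgs4_swap02 s))]

/-- The law after exchanging the marks `a, d`. -/
theorem law4_swap03 (p : E → ℝ) (a b c d : V) (s : Fin 15) :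
    G.law4 p d b c a s = G.law4 p a b c d (rowSwap03 s) := by
  have hm : (![d, b, c, a] : Fin 4 → V) = ![a, b, c, d] ∘ (Equiv.swap (0 : Fin 4) 3) := by
    funext i; fin_cases i <;> rfl
  simp only [law4]
  rw [hm, G.partitionEvent_comp_equiv, Equiv.symm_swap,
    G.partitionEvent_congr_ker _ (Setoid.ker_eq_of_iff (rgs4_swap03 s))]

/-- `Φ⁺` is invariant under exchanging the marks `a, b`. -/
theorem phiPlus_swap01 (p : E → ℝ) (a b c d : V) :
    G.PhiPlus p b a c d = G.PhiPlus p a b c d := by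
  simp only [PhiPlus, liabilitySum_eq, G.law4_swap01 p a b c d]
  simp [rowSwap01]
  ring

/-- `Φ⁺` is invariant under exchanging the marks `a, c`. -/
theorem phiPlus_swap02 (p : E → ℝ) (a b c d : V) :
    G.PhiPlus p c b a d = G.PhiPlus p a b c d := by
  simp only [PhiPlus, liabilitySum_eq, G.law4_swap02 p a b c d]
  simp [rowSwap02]
  ring

/-- `Φ⁺` is invariant under exchanging the marks `a, d`. -/
theorem phiPlus_swap03 (p : E → ℝ) (a b c d : V) :
    G.PhiPlus p d b c a = G.PhiPlus p a b c d := by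
  simp only [PhiPlus, liabilitySum_eq, G.law4_swap03 p a b c d]
  simp [rowSwap03]
  ring

omit [Fintype E] in
/-- A partition event does not see the orientation of an edge. -/
theorem partitionEvent_flipEdge (g : E) {k : ℕ} (m : Fin k → V) (r : Fin k → ℕ) :
    (G.flipEdge g).partitionEvent m r = G.partitionEvent m r := by
  ext ω
  simp only [partitionEvent, Set.mem_setOf_eq, flipEdge_conn]

/-- The law does not see the orientation of an edge. -/
theorem law4_flipEdge (g : E) (p : E → ℝ) (a b c d : V) :
    (G.flipEdge g).law4 p a b c d = G.law4 p a b c d := by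
  funext s
  simp only [law4, partitionEvent_flipEdge]

/-- `Φ⁺` does not see the orientation of an edge. -/
theorem phiPlus_flipEdge (g : E) (p : E → ℝ) (a b c d : V) :
    (G.flipEdge g).PhiPlus p a b c d = G.PhiPlus p a b c d := by
  simp only [PhiPlus, liabilitySum_eq, law4_flipEdge]

end MultiGraph

/-- Concavity along `g` for a relabelled tuple of marks is concavity for the original one
(helper for the four relabellings). -/
theorem concaveOn_phiPlus_congr {V E : Type} [Fintype E] [DecidableEq E] (G : MultiGraph V E)
    (p : E → ℝ) (g : E) {a b c d a' b' c' d' : V}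
    (h : ∀ q : E → ℝ, G.PhiPlus q a' b' c' d' = G.PhiPlus q a b c d)
    (hc : ConcaveOn ℝ (Set.Icc (0 : ℝ) 1) fun t => G.PhiPlus (Function.update p g t) a' b' c' d') :
    ConcaveOn ℝ (Set.Icc (0 : ℝ) 1) fun t => G.PhiPlus (Function.update p g t) a b c d := by
  simpa only [h] using hc

/-- Concavity along `g` in the flipped graph is concavity in the original graph. -/
theorem concaveOn_phiPlus_of_flipEdge {V E : Type} [Fintype E] [DecidableEq E]
    (G : MultiGraph V E) (p : E → ℝ) (g : E) (a b c d : V)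
    (hc : ConcaveOn ℝ (Set.Icc (0 : ℝ) 1) fun t =>
      (G.flipEdge g).PhiPlus (Function.update p g t) a b c d) :
    ConcaveOn ℝ (Set.Icc (0 : ℝ) 1) fun t => G.PhiPlus (Function.update p g t) a b c d := by
  simpa only [MultiGraph.phiPlus_flipEdge] using hc

/-- **Lemma 6 and 5b on every minor give the free-edge concavity lemma** (with the type identity):
the sure-connected mark is brought to the first position by a transposition (`Φ⁺` is
`S₄`-invariant) and the endpoint to `G.fst g` by flipping the edge. -/
theorem Concavity5Sure_of_Lemma6GenSure_5bSure (hid : TypeIdentity) (h6 : Lemma6GenSure)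
    (hb : Concavity5bSure) : Concavity5Sure := by
  intro V E _ _ G p hp a b c d hn g hg hm
  obtain ⟨m, hm, hu⟩ := hm
  -- the four relabellings, each with the two orientations
  have key : ∀ (a' b' c' d' : V), [a', b', c', d'].Nodup →
      (G.SureConn p (G.fst g) a' ∨ G.SureConn p (G.snd g) a') →
      ConcaveOn ℝ (Set.Icc (0 : ℝ) 1) fun t => G.PhiPlus (Function.update p g t) a' b' c' d' := by
    intro a' b' c' d' hn' hu'
    rcases hu' with hu' | hu'
    · exact concaveOn_of_Lemma6GenSure_5bSure hid h6 hb G p hp a' b' c' d' hn' g hg hu'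
    · refine concaveOn_phiPlus_of_flipEdge G p g a' b' c' d' ?_
      refine concaveOn_of_Lemma6GenSure_5bSure hid h6 hb (G.flipEdge g) p hp a' b' c' d' hn' g hg ?_
      rw [MultiGraph.flipEdge_fst_self, MultiGraph.flipEdge_sureConn]
      exact hu'
  rcases hm with rfl | rfl | rfl | rfl
  · exact key m b c d hn hu
  · have hn' : [m, a, c, d].Nodup := by
      simp only [List.nodup_cons, List.mem_cons, List.not_mem_nil, or_false,
        List.nodup_nil, and_true] at hn ⊢
      tauto
    exact concaveOn_phiPlus_congr G p g (fun q => G.phiPlus_swap01 q a m c d) (key m a c d hn' hu)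
  · have hn' : [m, b, a, d].Nodup := by
      simp only [List.nodup_cons, List.mem_cons, List.not_mem_nil, or_false,
        List.nodup_nil, and_true] at hn ⊢
      tauto
    exact concaveOn_phiPlus_congr G p g (fun q => G.phiPlus_swap02 q a b m d) (key m b a d hn' hu)
  · have hn' : [m, b, c, a].Nodup := by
      simp only [List.nodup_cons, List.mem_cons, List.not_mem_nil, or_false,
        List.nodup_nil, and_true] at hn ⊢
      tauto
    exact concaveOn_phiPlus_congr G p g (fun q => G.phiPlus_swap03 q a b c m) (key m b c a hn' hu)

/-- **The dossier's chain in the kernel**: `TypeIdentity → Lemma6GenSure → Concavity5bSure → C011`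
(and `C011 → C005`). -/
theorem C011_of_Lemma6GenSure_5bSure (hid : TypeIdentity) (h6 : Lemma6GenSure)
    (hb : Concavity5bSure) : C011 :=
  C011_of_Concavity5Sure (Concavity5Sure_of_Lemma6GenSure_5bSure hid h6 hb)

/-- `C005` from the same hypotheses. -/
theorem C005_of_Lemma6GenSure_5bSure (hid : TypeIdentity) (h6 : Lemma6GenSure)
    (hb : Concavity5bSure) : C005 :=
  C005_of_C011 (C011_of_Lemma6GenSure_5bSure hid h6 hb)

end PercRepro
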